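import Literature.Geometry.Lorentzian.GeodesicConfinement
import HarnessLib

/-!
# Compact Riemannian manifolds are geodesically complete

O'Neill 1983, Ch. 5, Cor. 23: "A compact Riemannian manifold is complete" (there: the Heine–Borel
condition of the Hopf–Rinow theorem, Thm. 21, holds trivially). Here the conclusion is geodesic
completeness of the Levi-Civita connection of a positive definite `C^n` metric `g`, `n ≥ 2`
(`Literature.Geometry.Lorentzian.IsGeodesicallyComplete g.leviCivita`: every maximal geodesic is
defined on all of `ℝ`), obtained without Hopf–Rinow as the special case `ρ = 0` of Gordon's
completeness criterion `PseudoRiemannianMetric.isGeodesicallyComplete_of_properFunction`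
(`GeodesicConfinement.lean`: a proper function with `g`-bounded gradient forces completeness; on a
compact manifold the zero function is proper). This is step (a) of the local/global geodesic
layer needed to identify the metric cut locus of `Literature/Geometry/Riemannian/CutLocus.lean`
with the classical one (Buchner 1977, p. 118, works on "a compact analytic Riemannian manifold",
whose geodesics are then defined for all time); see `CutLocusProofs.lean` for the plan.

No definitions and no named facts are introduced.

## References

* B. O'Neill, *Semi-Riemannian geometry with applications to relativity*, Academic Press 1983,
  Ch. 5, Thm. 21 (Hopf–Rinow) and Cor. 23 [ONeill1983].
* W. B. Gordon, *An analytical criterion for the completeness of Riemannian manifolds*, Proc.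
  Amer. Math. Soc. 37 (1973) 221–225 [Gordon1973].
-/

noncomputable section

open Set
open scoped Manifold ContDiff Topology

namespace Literature.Geometry.Riemannian

open Literature.Geometry.Lorentzian (PseudoRiemannianMetric IsGeodesicallyComplete)

variable {E : Type*} [NormedAddCommGroup E] [NormedSpace ℝ E] {H : Type*} [TopologicalSpace H]
  {I : ModelWithCorners ℝ E H} {M : Type*} [TopologicalSpace M] [ChartedSpace H M]
  [IsManifold I ∞ M] {n : ℕ∞ω}
  {g : PseudoRiemannianMetric I n E (TangentSpace I : M → Type _)}

/-- **A compact Riemannian manifold is geodesically complete** (O'Neill 1983, Ch. 5, Cor. 23: "A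
compact Riemannian manifold is complete"): for a positive definite `C^n` metric `g`, `n ≥ 2`, on a
compact Hausdorff manifold without boundary (finite-dimensional complete model space), every
tangent vector is the initial velocity of a geodesic of the Levi-Civita connection defined on all
of `ℝ`. Proof: Gordon's criterion `isGeodesicallyComplete_of_properFunction` with the proper
function `ρ = 0` (gradient bound `L = 0`; every sublevel set lies in the compact `univ`).
[cite: ONeill1983, Ch. 5, Cor. 23] -/
theorem _root_.Literature.Geometry.Lorentzian.PseudoRiemannianMetric.isGeodesicallyComplete_of_compactSpace
    [CompleteSpace E] [T2Space M] [BoundarylessManifold I M] [CompactSpace M]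
    [FiniteDimensional ℝ E] [Fact (1 ≤ n)] [g.HasLeviCivita] (hn : 2 ≤ n)
    (hg : g.IsRiemannian) : IsGeodesicallyComplete g.leviCivita :=
  g.isGeodesicallyComplete_of_properFunction hn hg (ρ := fun _ => (0 : ℝ)) (L := 0) le_rfl
    (fun _ => mdifferentiableAt_const)
    (fun q v => by rw [mvfderiv_const]; simp)
    (fun _ => ⟨univ, isCompact_univ, fun q _ => mem_univ q⟩)

end Literature.Geometry.Riemannian
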